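import Summits.HodgeConjecture.HodgeConjecture.Theorems.MarkmanPartnerTransportPicardThreeK3SquaresOneCycleIff
import Literature.AlgebraicGeometry.HodgeTheory.HodgeClassOfMorphismDischarge
import Literature.AlgebraicGeometry.HodgeTheory.ComplexGysinCorrespondence

/-!
# Route MarkmanPartnerTransport · crux `PicardThreeK3Squares` (stmt-HodgeConjecture-19652) —
# ONE CYCLE SUFFICES, part 11: the iff in van Geemen–Schütt's vocabulary — HC⁴(S ⊗ S) ⟺ `S` carries a
# CYCLE-INDUCED TRANSCENDENTAL ENDOMORPHISM generating `End_Hdg T(S)`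

Part 7's `Ψ = η⁻¹(a ⊕ id_N)_ℂη` (`a` primitive in `End_Hdg T`) minus the identity (the diagonal class) is
`t = η⁻¹((a - 1) ⊕ 0_N)_ℂη`: rational, type-preserving, KILLING `N¹`, image `⊥ N¹`, induced by `γ - [Δ]`,
still generating — EXACTLY `IsCycleInducedTranscendentalEndomorphism` + `TranscendentalEndomorphismsGeneratedBy`:

* `exists_isCycleInduced_generating_of_hodgeConjectureFor_square` — HC⁴(S ⊗ S) ⇒ ∃ t,
  `IsCycleInducedTranscendentalEndomorphism S _ t ∧ TranscendentalEndomorphismsGeneratedBy S t`;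
* `hodgeConjectureFor_square_iff_exists_isCycleInduced_generating` — **HC⁴(S ⊗ S) ⟺ ∃ such t** (⇐ is the
  tree's rung F4 `SquareOfGenerator.hodgeConjectureFor_tensor_self_of_generated`), granted markings: the
  shape `IsCycleInducedRMK3` (minus its minimal-polynomial and non-CM clauses) is not only sufficient
  (van Geemen–Schütt Rem. 4.9 / Varesco) but NECESSARY for the Hodge conjecture of a K3 square.

No definition, no sorry; markings only. Prover seat hodge-nonav-19652-p1 (gen 8), `--supports
stmt-HodgeConjecture-19652`. Nothing here proves the crux or HC. References: van Geemen–Schütt, Forum Math.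
Sigma 13 (2025) e2, §4.8, Rem. 4.9; Varesco, Math. Z. 305 (2023), §2; Voisin, *Hodge Theory I*, Lemma 11.41.
-/

set_option linter.dupNamespace false

noncomputable section


namespace Summit.HodgeConjecture.HodgeConjecture.Theorems.MarkmanPartnerTransport.OneCycle

open scoped Manifold TensorProduct
open Module CategoryTheory MonoidalCategory CartesianMonoidalCategory Polynomial
open Literature.AlgebraicGeometry Literature.AlgebraicGeometry.Motives Literature.AlgebraicGeometry.HodgeTheory
open Literature.AlgebraicGeometry.Motives.HodgeStructure
open Literature.AlgebraicGeometry.Surfaces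
open Literature.AlgebraicTopology.SingularHomology
open Summit.HodgeConjecture.HodgeConjecture.Theorems
open Summit.HodgeConjecture.HodgeConjecture.Theorems.NikulinTwinTransport
open Summit.HodgeConjecture.HodgeConjecture.Theorems.AnchorExistenceCMFloor
open Summit.HodgeConjecture.HodgeConjecture.Theorems.MarkmanPartnerTransport.RealMultiplicationRanks

variable {S : SchemeOver ℂ}

/-- `Corr[μ, hS ; γ, y] = pr₁_*(pr₂^* y ∪ γ)`. Local notation only. -/
local notation3 (prettyPrint := false) "Corr[" μ ", " hS " ; " γ ", " y "]" =>
  complexGysin μ (IsSmoothProjective.tensor_holds hS hS) hS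
    (SemiCartesianMonoidalCategory.fst _ _) (rfl : 2 * 1 + 2 * 2 + 2 * 2 = 2 * 1 + 2 * (2 + 2))
    (cupProduct (rfl : 2 * 1 + 2 * 2 = 2 * 1 + 2 * 2)
      (complexBetti.map (SemiCartesianMonoidalCategory.snd _ _) (2 * 1) y) γ)

/-! ### HC⁴(S ⊗ S) ⟹ a cycle-induced transcendental endomorphism generates `End_Hdg(T(S))` -/

/-- **Under HC⁴(S ⊗ S), `S` carries a cycle-induced transcendental endomorphism (van Geemen–Schütt's
`IsCycleInducedTranscendentalEndomorphism`: rational, type-preserving, killing `N¹`, image `⊥ N¹`, induced by an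
algebraic class on `S × S`) that GENERATES `End_Hdg T(S)`**: `t = η⁻¹((a - 1) ⊕ 0_N)_ℂ η = Ψ - [Δ]_*`, `a`
primitive (part 7, Voisin I 11.41 + HC⁴). [cite: GeemenSchutt2023, §4.8 and Rem. 4.9] [cite: Varesco2023, §2 (p. 8)] -/
theorem exists_isCycleInduced_generating_of_hodgeConjectureFor_square (hmark : Huybrechts_K3_marking_exists)
    (hS : IsK3Surface S) (hHC : HodgeConjectureFor 4 (S ⊗ S)) :
    ∃ t : complexBetti S (2 * 1) →ₗ[ℂ] complexBetti S (2 * 1),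
      IsCycleInducedTranscendentalEndomorphism S hS.isSmoothProjective t ∧
      TranscendentalEndomorphismsGeneratedBy S t := by
  classical
  have hHT : Huybrechts_K3_hodgeTypes_H2 := Huybrechts_K3_hodgeTypes_H2_holds
  obtain ⟨η, p₀, x, hp₀, ⟨hp₀int, hp₀gen, hηint, hηcup, hx20, hx20'⟩, hxx, hxpos, hu⟩ := hmark S hS
  set N := algebraicClasses S 1 with hNdef
  set σ := η.symm x with hσdef
  have hησ : η σ = x := by rw [hσdef, LinearEquiv.apply_symm_apply]
  have hxne : σ ≠ 0 := by
    intro h0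
    have hx : x = 0 := by rw [← hησ, h0, map_zero]
    subst hx
    simp [k3Form] at hxpos
  have hxne' : x ≠ 0 := fun h => hxne (by rw [hσdef, h, map_zero])
  obtain ⟨h₁, -, h₃⟩ := hHT S hS σ hx20 hxne
  have hσbar : conjClass (ComplexPoints S) (2 * 1) σ = η.symm (star x) := conjClass_marking_symm η hηint x
  have hsmul0 : ∀ {c : ℂ}, c • p₀ = 0 → c = 0 := fun h => by
    rcases smul_eq_zero.1 h with h | h
    · exact h
    · exact absurd h hp₀
  have hL11 : ∀ c : complexBetti S (2 * 1), IsRationalClass c → IsOfHodgeType 2 S (2 * 1) 1 1 c → c ∈ N :=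
    fun c hc h11 => lefschetzOneOne_rational_holds hS.1 c hc h11
  have hND : ∀ c ∈ N, IsRationalClass c →
      (∀ d ∈ N, cupProduct (rfl : 2 * 1 + 2 * 1 = 2 * 2) c d = 0) → c = 0 :=
    fun c hcN hc hperp => anchorExistence_cmFloor_divisorClass_eq_zero_of_hodgeIndex
      hodgeIndex_surface_holds lefschetzOneOne_rational_holds
      Grothendieck1969_supportedClasses_le_hodgeConiveau_holds hS hcN hc hperp
  -- rational classes are `Λ_ℚ`
  have hrat : ∀ c, IsRationalClass c ↔ ∃ w : K3Index → ℚ, η c = fun i => (w i : ℂ) :=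
    isRationalClass_iff_of_marking hS η hηint
  -- the rational points of `N`
  let NQ : Submodule ℚ (K3Index → ℚ) :=
    { carrier := {u | η.symm (fun j => (u j : ℂ)) ∈ N}
      add_mem' := fun {u v} hu hv => by
        simp only [Set.mem_setOf_eq, ratCastΛ_add, map_add]
        exact N.add_mem hu hv
      zero_mem' := by
        simp only [Set.mem_setOf_eq, ratCastΛ_zero, map_zero]
        exact N.zero_mem
      smul_mem' := fun q u hu => by
        simp only [Set.mem_setOf_eq, ratCastΛ_smul, map_smul]
        exact N.smul_mem _ hu }
  have memNQ : ∀ u, u ∈ NQ ↔ η.symm (fun j => (u j : ℂ)) ∈ N := fun u => Iff.rfl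
  -- `(1,1)`-classes through the marking
  have h11_iff : ∀ v : K3Index → ℂ, IsOfHodgeType 2 S (2 * 1) 1 1 (η.symm v) ↔
      (k3Form v x = 0 ∧ k3Form v (star x) = 0) := by
    intro v
    rw [h₃ (η.symm v), hηcup, hηcup, LinearEquiv.apply_symm_apply, hησ, hσbar, LinearEquiv.apply_symm_apply]
    constructor
    · rintro ⟨ha, hb⟩
      exact ⟨hsmul0 ha, hsmul0 hb⟩
    · rintro ⟨ha, hb⟩
      rw [ha, hb, zero_smul]
      exact ⟨rfl, rfl⟩
  -- `N_ℚ = Λ_ℚ ∩ {x, x̄}^⊥`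
  have hN : ∀ u : K3Index → ℚ, u ∈ NQ ↔
      (k3Form (fun i => (u i : ℂ)) x = 0 ∧ k3Form (fun i => (u i : ℂ)) (star x) = 0) := by
    intro u
    rw [memNQ, ← h11_iff]
    constructor
    · intro hu
      exact isOfHodgeType_of_mem_algebraicClasses_of_isSmoothProjective hS.1 1 hu
    · intro hu
      exact hL11 _ ((hrat _).2 ⟨u, LinearEquiv.apply_symm_apply _ _⟩) hu
  -- `N` is spanned by its rational classes, so `N_ℚ^⊥ ⊗ ℂ ⊥ N`
  have hspan := span_isRationalClass_eq_top_of_isSmoothProjective_holds.supportedClasses_eq_span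
    hS.1 (2 * 1) 1
  have horth : ∀ u ∈ k3FormRat.orthogonal NQ, ∀ d ∈ N, k3Form (fun j => (u j : ℂ)) (η d) = 0 := by
    intro u hu d hd
    rw [LinearMap.BilinForm.mem_orthogonal_iff] at hu
    have hd' : d ∈ Submodule.span ℂ {c : complexBetti S (2 * 1) |
        IsRationalClass c ∧ c ∈ supportedClasses S (2 * 1) 1} := by
      rw [← hspan]; exact hd
    clear hd
    induction hd' using Submodule.span_induction with
    | mem d hd =>
      obtain ⟨w, hw⟩ := (hrat d).1 hd.1
      have hwN : w ∈ NQ := by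
        rw [memNQ, ← hw, LinearEquiv.symm_apply_apply]
        exact hd.2
      rw [hw, k3Form_ratCast, k3FormRat_isSymm.eq, hu w hwN, Rat.cast_zero]
    | zero => rw [map_zero, k3Form_zero_right]
    | add c c' _ _ hc hc' => rw [map_add, k3Form_add_right, hc, hc', add_zero]
    | smul t c _ hc => rw [map_smul, k3Form_smul_right, hc, mul_zero]
  -- `N_ℚ ∩ N_ℚ^⊥ = 0` (Hodge index)
  have hdisj : Disjoint NQ (k3FormRat.orthogonal NQ) := by
    rw [Submodule.disjoint_def]
    intro u huN huT
    have hc0 : η.symm (fun j => (u j : ℂ)) = 0 :=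
      hND _ ((memNQ u).1 huN) ((hrat _).2 ⟨u, LinearEquiv.apply_symm_apply _ _⟩) fun d hd => by
        rw [hηcup, LinearEquiv.apply_symm_apply, horth u huT d hd, zero_smul]
    apply ratCastΛ_injective
    rw [ratCastΛ_zero]
    exact η.symm.injective (hc0.trans (map_zero _).symm)
  have hc := isCompl_orthogonal hdisj
  -- the transcendental Hodge structure, irreducible of K3 type, polarized; its endomorphism field
  set H := hodgeT hN hdisj hxx hxpos with hH
  have hK3 : H.IsOfK3Type := isOfK3Type_hodgeT hN hdisj hxx hxpos
  have hirr : H.IsIrreducible := isIrreducible_hodgeT hN hdisj hxx hxpos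
  set ψ : H.Polarization := polT hN hdisj hxx hxpos hu with hψ
  obtain ⟨hFld, ε, -, hε⟩ := Zarhin1983_endAlg_isField_holds H hirr hK3
  have hω : omega x hdisj ∈ H.piece 2 0 := (mem_piece_two_zero_ofPeriod _ _).2 ⟨1, one_smul _ _⟩
  -- reading a rational type-preserving endomorphism of `H²(S)` in `E = End_Hdg(T)`
  have read : ∀ (G : complexBetti S (2 * 1) →ₗ[ℂ] complexBetti S (2 * 1)),
      (∀ y, IsRationalClass y → IsRationalClass (G y)) →
      (∀ (i j : ℕ) y, IsOfHodgeType 2 S (2 * 1) i j y → IsOfHodgeType 2 S (2 * 1) i j (G y)) →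
      ∃ (φ : Module.End ℚ (K3Index → ℚ)) (hφT : ∀ t ∈ k3FormRat.orthogonal NQ,
          φ t ∈ k3FormRat.orthogonal NQ),
        cxEnd φ = η.toLinearMap ∘ₗ G ∘ₗ η.symm.toLinearMap ∧ φ.restrict hφT ∈ H.endAlg := by
    intro G hG_rat hG_typ
    obtain ⟨φ, hφM, hφx, hφ11⟩ := anchorExistence_cmFloor_exists_ratEnd hHT hS η p₀ hp₀ hηint hηcup x hx20
      hx20' hxne G hG_rat hG_typ
    have hφT : ∀ t ∈ k3FormRat.orthogonal NQ, φ t ∈ k3FormRat.orthogonal NQ :=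
      fun t ht => map_mem_T hN φ hφx ht
    exact ⟨φ, hφT, hφM, restrict_mem_endAlg hN hdisj hxx hxpos φ hφT hφx hφ11⟩
  obtain ⟨a, b, hba, -, hb⟩ := exists_forall_eq_aeval_sub_one_of_isField hFld
  set μ : ℂ := ε a with hμdef
  have hamem : ((a : H.endAlg) : Module.End ℚ ↥(k3FormRat.orthogonal NQ)) ∈ H.endAlg := a.2
  set û : Module.End ℚ (K3Index → ℚ) := extendT hdisj (a : Module.End ℚ ↥(k3FormRat.orthogonal NQ)) with hû
  have hûx : cxEnd û x = μ • x := by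
    have h := hε a (omega x hdisj) hω
    have h2 := congrArg (iota (k3FormRat.orthogonal NQ)) h
    rw [iota_baseChange hdisj, iota_omega hN hdisj, map_smul, iota_omega hN hdisj] at h2
    exact h2
  have hû11 : ∀ z : K3Index → ℂ, k3Form z x = 0 → k3Form z (star x) = 0 →
      k3Form (cxEnd û z) x = 0 ∧ k3Form (cxEnd û z) (star x) = 0 :=
    fun z hzx hzx' => k3Form_cxEnd_extendT hN hdisj hxx hxpos hamem hzx hzx'
  let Ψ : complexBetti S (2 * 1) →ₗ[ℂ] complexBetti S (2 * 1) :=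
    η.symm.toLinearMap ∘ₗ cxEnd û ∘ₗ η.toLinearMap
  have hΨapp : ∀ y, Ψ y = η.symm (cxEnd û (η y)) := fun y => rfl
  have hΨrat : ∀ y, IsRationalClass y → IsRationalClass (Ψ y) := by
    intro y hy
    obtain ⟨w, hw⟩ := (hrat y).1 hy
    rw [hΨapp, hw, cxEnd_ratCast]
    exact (hrat _).2 ⟨û w, LinearEquiv.apply_symm_apply _ _⟩
  have hΨσ : Ψ σ = μ • σ := by rw [hΨapp, hησ, hûx, map_smul]
  have hΨtyp : ∀ (i j : ℕ) y, IsOfHodgeType 2 S (2 * 1) i j y → IsOfHodgeType 2 S (2 * 1) i j (Ψ y) := by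
    refine typePreserving_of_lines hHT hS hx20 hxne Ψ ⟨μ, hΨσ⟩ ⟨star μ, ?_⟩ fun v hv => ?_
    · rw [hσbar, hΨapp, LinearEquiv.apply_symm_apply, cxEnd_star, hûx, star_smul, map_smul]
    · have hv' := hv
      rw [← LinearEquiv.symm_apply_apply η v, h11_iff] at hv'
      rw [hΨapp, h11_iff]
      exact hû11 (η v) hv'.1 hv'.2
  have hûT : ∀ t ∈ k3FormRat.orthogonal NQ, û t ∈ k3FormRat.orthogonal NQ := fun t ht => by
    rw [hû, extendT_apply_coe hdisj _ ⟨t, ht⟩]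
    exact (((a : H.endAlg) : Module.End ℚ ↥(k3FormRat.orthogonal NQ)) ⟨t, ht⟩).2
  have hre_eq : û.restrict hûT = ((a : H.endAlg) : Module.End ℚ ↥(k3FormRat.orthogonal NQ)) := by
    refine LinearMap.ext fun t => Subtype.ext ?_
    rw [LinearMap.coe_restrict_apply, hû, extendT_apply_coe]
  have hre : û.restrict hûT ∈ H.endAlg := by
    rw [hre_eq]
    exact a.2
  have hre_a : (⟨û.restrict hûT, hre⟩ : H.endAlg) = a := Subtype.ext hre_eq
  have hûMapp : ∀ v, cxEnd û v = η (Ψ (η.symm v)) := fun v => by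
    rw [hΨapp, LinearEquiv.apply_symm_apply, LinearEquiv.apply_symm_apply]
  have hcxpow : ∀ i : ℕ, cxEnd (û ^ i) = cxEnd û ^ i := fun i => map_pow cxEndHom û i
  have hΨcyc : ∃ γ ∈ algebraicClasses (S ⊗ S) 2, ∀ y : complexBetti S (2 * 1),
      Ψ y = Corr[complexOrientationFamily, hS.isSmoothProjective ; γ, y] := by
    have hI := hodgePQ_independent_of_hodgeModel_holds
    obtain ⟨A⟩ := nonempty_hodgeModel_holds (n := 2) (X := S) hS.1
    obtain ⟨γ, hγQ, hγT, t, ht0, hγ⟩ := exists_hodgeClass_corrAction_eq_smul_holds hS.1 hS.1 A A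
      (a := 2 * 1) (b := 2 * 1) (e := 2) (r := 0) (rfl : 2 * 1 + 2 * 2 = 2 * 1 + 2 * 2)
      (rfl : 2 + 0 = 2) Ψ hΨrat
      (fun p q _ c hc ↦ by
        rw [Nat.add_zero, Nat.add_zero]
        exact (hI.isOfHodgeType_iff hS.1 A).1 (hΨtyp p q c ((hI.isOfHodgeType_iff hS.1 A).2 hc)))
      complexOrientationFamily
    have hγalg : γ ∈ algebraicClasses (S ⊗ S) 2 := hHC.2 2 γ hγQ hγT
    refine ⟨t⁻¹ • γ, Submodule.smul_mem _ _ hγalg, fun y ↦ ?_⟩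
    have h := LinearMap.congr_fun hγ y
    rw [LinearMap.smul_apply, corrAction_apply] at h
    rw [map_smul, map_smul, h, smul_smul, inv_mul_cancel₀ ht0, one_smul]
  -- `ι(ℂ ⊗ T) ⊥ N`
  have horth' : ∀ (z : ℂ ⊗[ℚ] ↥(k3FormRat.orthogonal NQ)), ∀ d ∈ N, k3Form (iota _ z) (η d) = 0 := by
    intro z d hd
    have hd' : d ∈ Submodule.span ℂ {c : complexBetti S (2 * 1) |
        IsRationalClass c ∧ c ∈ supportedClasses S (2 * 1) 1} := by
      rw [← hspan]; exact hd
    clear hd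
    induction hd' using Submodule.span_induction with
    | mem d hd =>
      obtain ⟨w, hw⟩ := (hrat d).1 hd.1
      have hwN : w ∈ NQ := by
        rw [memNQ, ← hw, LinearEquiv.symm_apply_apply]
        exact hd.2
      rw [hw, k3Form_iota_of_mem _ hwN]
    | zero => rw [map_zero, k3Form_zero_right]
    | add c c' _ _ hc hc' => rw [map_add, k3Form_add_right, hc, hc', add_zero]
    | smul r c _ hc => rw [map_smul, k3Form_smul_right, hc, mul_zero]
  set φ₀ : Module.End ℚ (K3Index → ℚ) := û - 1 with hφ₀
  let t : complexBetti S (2 * 1) →ₗ[ℂ] complexBetti S (2 * 1) := Ψ - LinearMap.id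
  have htapp : ∀ y, t y = Ψ y - y := fun y => rfl
  have hφ₀T : ∀ v ∈ k3FormRat.orthogonal NQ, φ₀ v ∈ k3FormRat.orthogonal NQ := fun v hv => by
    rw [hφ₀, LinearMap.sub_apply, Module.End.one_apply]
    exact Submodule.sub_mem _ (hûT v hv) hv
  have hφ₀Mapp : ∀ v, cxEnd φ₀ v = η (t (η.symm v)) := fun v => by
    rw [hφ₀, cxEnd_sub, LinearMap.sub_apply, cxEnd_one, Module.End.one_apply, hûMapp, htapp, map_sub,
      LinearEquiv.apply_symm_apply]
  have hcxpow₀ : ∀ i : ℕ, cxEnd (φ₀ ^ i) = cxEnd φ₀ ^ i := fun i => map_pow cxEndHom φ₀ i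
  have hre₀_eq : φ₀.restrict hφ₀T = ((a : H.endAlg) : Module.End ℚ ↥(k3FormRat.orthogonal NQ)) - 1 := by
    refine LinearMap.ext fun v => Subtype.ext ?_
    rw [LinearMap.coe_restrict_apply, hφ₀, LinearMap.sub_apply, Module.End.one_apply, LinearMap.sub_apply,
      Submodule.coe_sub, Module.End.one_apply, hû, extendT_apply_coe]
  have hre₀ : φ₀.restrict hφ₀T ∈ H.endAlg := by
    have h := b.2
    rw [hba, ← hre₀_eq] at h
    exact h
  have hre₀_a : (⟨φ₀.restrict hφ₀T, hre₀⟩ : H.endAlg) = b := Subtype.ext (hre₀_eq.trans hba.symm)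
  have ha₀ : ∀ s : H.endAlg, ∃ P : ℚ[X], s = aeval (⟨φ₀.restrict hφ₀T, hre₀⟩ : H.endAlg) P := by
    rw [hre₀_a]
    exact hb
  have ht_rat : ∀ y, IsRationalClass y → IsRationalClass (t y) := by
    intro y hy
    obtain ⟨w, hw⟩ := (hrat y).1 hy
    refine (hrat _).2 ⟨φ₀ w, ?_⟩
    rw [← cxEnd_ratCast, ← hw, hφ₀Mapp, LinearEquiv.symm_apply_apply]
  have ht_typ : ∀ (i j : ℕ) y, IsOfHodgeType 2 S (2 * 1) i j y → IsOfHodgeType 2 S (2 * 1) i j (t y) :=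
    fun i j y hy => by rw [htapp]; exact (hΨtyp i j y hy).sub hS.1 hy
  have ht_N : ∀ d ∈ N, t d = 0 := by
    intro d hd
    have hd' : d ∈ Submodule.span ℂ {c : complexBetti S (2 * 1) |
        IsRationalClass c ∧ c ∈ supportedClasses S (2 * 1) 1} := by
      rw [← hspan]; exact hd
    clear hd
    induction hd' using Submodule.span_induction with
    | mem c hc =>
      obtain ⟨w, hw⟩ := (hrat c).1 hc.1
      have hwN : w ∈ NQ := by
        rw [memNQ, ← hw, LinearEquiv.symm_apply_apply]
        exact hc.2
      have hc' : c = η.symm (fun j => (w j : ℂ)) := by rw [← hw, LinearEquiv.symm_apply_apply]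
      rw [htapp, hΨapp, hw, cxEnd_ratCast, hû, extendT_apply_of_mem hdisj _ hwN, hc', sub_self]
    | zero => rw [map_zero]
    | add c c' _ _ hc hc' => rw [map_add, hc, hc', add_zero]
    | smul r c _ hc => rw [map_smul, hc, smul_zero]
  have ht_perp : ∀ (y : complexBetti S (2 * 1)), ∀ d ∈ N,
      cupProduct (rfl : 2 * 1 + 2 * 1 = 2 * 2) (t y) d = 0 := by
    intro y d hd
    have hdecomp := cxEnd_projection_add_apply hc (η y)
    have h0 : cxEnd φ₀ (cxEnd (NQ.projection _ hc) (η y)) = 0 := by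
      rw [hφ₀, cxEnd_sub, LinearMap.sub_apply, cxEnd_one, Module.End.one_apply,
        ← LinearMap.comp_apply (cxEnd û) (cxEnd (NQ.projection _ hc)) (η y), ← cxEnd_comp, hû,
        extendT_comp_projection, sub_self]
    have h1 : η (t y) = cxEnd φ₀ (η y) := by rw [hφ₀Mapp, LinearEquiv.symm_apply_apply]
    have hηt : η (t y) = iota _ ((φ₀.restrict hφ₀T).baseChange ℂ (lam hc (η y))) := by
      rw [iota_baseChange_restrict φ₀ hφ₀T, iota_lam, h1]
      conv_lhs => rw [← hdecomp]
      rw [map_add, h0, zero_add]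
    rw [hηcup, hηt, horth' _ d hd, zero_smul]
  have ht_cyc : ∃ γ ∈ algebraicClasses (S ⊗ S) 2, ∀ y : complexBetti S (2 * 1),
      t y = Corr[complexOrientationFamily, hS.isSmoothProjective ; γ, y] := by
    obtain ⟨γ, hγ, hΨγ⟩ := hΨcyc
    refine ⟨γ - complexGysin complexOrientationFamily hS.1 (IsSmoothProjective.tensor_holds hS.1 hS.1)
        (lift (𝟙 S) (𝟙 S)) (rfl : 0 + 2 * (2 + 2) = 2 * 2 + 2 * 2) (singularCohomology.one ℂ (ComplexPoints S)),
      Submodule.sub_mem _ hγ (diagonal_mem_algebraicClasses complexOrientationFamily hS.1 _), fun y ↦ ?_⟩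
    rw [htapp, hΨγ, map_sub, map_sub, corrFst_diagonal complexOrientationFamily hS.1 rfl rfl rfl y]
  refine ⟨t, ⟨ht_rat, ht_typ, ht_N, ht_perp, ht_cyc⟩, ?_⟩
  intro f hf_rat hf_typ _ _
  obtain ⟨φf, hφfT, hφfM, hrf⟩ := read f hf_rat hf_typ
  have hφfMapp : ∀ v, cxEnd φf v = η (f (η.symm v)) := fun v => by rw [hφfM]; rfl
  obtain ⟨P, hP⟩ := ha₀ ⟨φf.restrict hφfT, hrf⟩
  have hTeq : ∀ t ∈ k3FormRat.orthogonal NQ,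
      φf t = ∑ i ∈ Finset.range (P.natDegree + 1), P.coeff i • (φ₀ ^ i) t := by
    intro t ht
    have h1 : (φf.restrict hφfT : Module.End ℚ ↥(k3FormRat.orthogonal NQ)) =
        aeval (φ₀.restrict hφ₀T) P := by
      have h := congrArg Subtype.val hP
      rw [Polynomial.aeval_subalgebra_coe] at h
      exact h
    have h2 := congrArg Subtype.val (LinearMap.congr_fun h1 ⟨t, ht⟩)
    rw [LinearMap.coe_restrict_apply, Polynomial.aeval_eq_sum_range, LinearMap.sum_apply,
      Submodule.coe_sum] at h2
    rw [h2]
    refine Finset.sum_congr rfl fun i _ => ?_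
    rw [LinearMap.smul_apply, Submodule.coe_smul, Module.End.pow_restrict i hφ₀T,
      LinearMap.coe_restrict_apply]
  have hpowη : ∀ (i : ℕ) (y : complexBetti S (2 * 1)), (cxEnd φ₀ ^ i) (η y) = η ((t ^ i) y) := by
    intro i
    induction i with
    | zero => intro y; rw [pow_zero, pow_zero, Module.End.one_apply, Module.End.one_apply]
    | succ i ih =>
      intro y
      rw [pow_succ', pow_succ', Module.End.mul_apply, Module.End.mul_apply, ih, hφ₀Mapp,
        LinearEquiv.symm_apply_apply]
  have hcx : ∀ z : ℂ ⊗[ℚ] ↥(k3FormRat.orthogonal NQ),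
      cxEnd φf (iota _ z) = ∑ i ∈ Finset.range (P.natDegree + 1),
        ((P.coeff i : ℚ) : ℂ) • (cxEnd φ₀ ^ i) (iota _ z) := by
    intro z
    induction z using TensorProduct.induction_on with
    | zero => simp only [map_zero, smul_zero, Finset.sum_const_zero]
    | tmul a t =>
      rw [iota_tmul, map_smul, cxEnd_ratCast, hTeq _ t.2, ratCastΛ_sum, Finset.smul_sum]
      refine Finset.sum_congr rfl fun i _ => ?_
      rw [ratCastΛ_smul, ← cxEnd_ratCast, hcxpow₀, map_smul, smul_comm]
    | add z₁ z₂ h₁ h₂ =>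
      rw [map_add, map_add, h₁, h₂, ← Finset.sum_add_distrib]
      refine Finset.sum_congr rfl fun i _ => ?_
      rw [map_add, smul_add]
  refine ⟨P.natDegree + 1, fun i => P.coeff i, fun y hy => ?_⟩
  have hzN : ∀ n ∈ NQ, k3Form (η y) (fun i => (n i : ℂ)) = 0 := by
    intro n hn
    have h := hy _ ((memNQ n).1 hn)
    rw [hηcup, LinearEquiv.apply_symm_apply] at h
    exact hsmul0 h
  have hz0 : cxEnd (NQ.projection _ hc) (η y) = 0 := cxEnd_projection_eq_zero hdisj hzN
  have hz : iota _ (lam hc (η y)) = η y := iota_lam_of_proj_eq_zero hc hz0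
  have hfy : f y = η.symm (cxEnd φf (η y)) := by
    rw [hφfMapp, LinearEquiv.symm_apply_apply, LinearEquiv.symm_apply_apply]
  rw [hfy, ← hz, hcx, hz, map_sum, Finset.sum_range]
  refine Finset.sum_congr rfl fun i _ => ?_
  rw [map_smul, hpowη, LinearEquiv.symm_apply_apply]

/-! ### The criterion in van Geemen–Schütt's vocabulary -/

/-- **HC⁴(S ⊗ S) ⟺ `S` carries a cycle-induced transcendental endomorphism generating `End_Hdg T(S)`**
(every projective K3 surface, every Picard number; granted markings): the shape of the tree's
`IsCycleInducedRMK3` — minus its minimal-polynomial and non-CM clauses — is necessary AND sufficient.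
(⇒) `exists_isCycleInduced_generating_of_hodgeConjectureFor_square`; (⇐) the rung F4
`SquareOfGenerator.hodgeConjectureFor_tensor_self_of_generated`. [cite: GeemenSchutt2023, §4.8 and Rem. 4.9]
[cite: Varesco2023, §2 (p. 8)] -/
theorem hodgeConjectureFor_square_iff_exists_isCycleInduced_generating (hmark : Huybrechts_K3_marking_exists)
    (hS : IsK3Surface S) :
    HodgeConjectureFor 4 (S ⊗ S) ↔
      ∃ t : complexBetti S (2 * 1) →ₗ[ℂ] complexBetti S (2 * 1),
        IsCycleInducedTranscendentalEndomorphism S hS.isSmoothProjective t ∧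
        TranscendentalEndomorphismsGeneratedBy S t :=
  ⟨exists_isCycleInduced_generating_of_hodgeConjectureFor_square hmark hS,
    fun ⟨t, ht, hgen⟩ ↦ SquareOfGenerator.hodgeConjectureFor_tensor_self_of_generated hS t ht hgen⟩

end Summit.HodgeConjecture.HodgeConjecture.Theorems.MarkmanPartnerTransport.OneCycle

end
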